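import Mathlib.LinearAlgebra.CrossProduct
import Mathlib.LinearAlgebra.Matrix.DotProduct
import Mathlib.MeasureTheory.Measure.Lebesgue.Basic
import Mathlib.MeasureTheory.Measure.Haar.Unique
import Literature.Analysis.FluidPDE.FiniteFourierModeEulerLune

/-!
# Solid angles II: wedges (lunes) in general position

Support file for `FiniteFourierModeEuler` (N. Kishimoto, T. Yoneda, J. Math. Fluid Mech. 24
(2022) 74 = arXiv:2110.08039), continuing `FiniteFourierModeEulerLune`: we move the standard wedge
to general position by an orthonormal change of coordinates (a `3 × 3` matrix of determinant one,
which preserves Lebesgue measure and the round ball): the open lune `{x·n₁ > 0, x·n₂ > 0}` between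
two planes through the origin with independent normals occupies the fraction `α/(2π)` of the round
ball, `α = arccos(-(n₁·n₂)/(|n₁||n₂|)) ∈ (0, π)` its opening angle (`volume_lune_inter_ball₃`).
This is the measure-theoretic input ("area of a spherical polygon", Gauss–Bonnet) of Lemma 4.6 and
of the proofs of Prop. 4.4 (iv) and Prop. 4.7, via Girard's theorem (`FiniteFourierModeEulerGirard`).

## References

* [KishimotoYoneda2022] N. Kishimoto, T. Yoneda, J. Math. Fluid Mech. 24 (2022) 74 =
  arXiv:2110.08039, §4 Lemma 4.6 ("the celebrated Gauss–Bonnet theorem tells us that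
  `A(F*) = Θ(F*) - (p-2)π`").
* [folklore] A. Girard (1629), area of a spherical triangle.
-/

noncomputable section

open MeasureTheory Set Real ENNReal Matrix

namespace Literature.Analysis.FluidPDE

namespace KY

/-! ### Open half spaces and lunes -/

/-- The open half space `{x ⬝ᵥ n > 0}`. [folklore] -/
def halfSpace (n : Fin 3 → ℝ) : Set (Fin 3 → ℝ) := {x | 0 < x ⬝ᵥ n}

/-- The open lune (wedge) between two half spaces. [folklore] -/
def lune (n₁ n₂ : Fin 3 → ℝ) : Set (Fin 3 → ℝ) := halfSpace n₁ ∩ halfSpace n₂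

/-- The opening angle of the lune `{x ⬝ᵥ n₁ > 0, x ⬝ᵥ n₂ > 0}`: `arccos (-(n₁·n₂)/(|n₁||n₂|))`,
i.e. `π` minus the angle between the normals. [folklore] -/
def luneAngle (n₁ n₂ : Fin 3 → ℝ) : ℝ :=
  Real.arccos (-(n₁ ⬝ᵥ n₂) / (Real.sqrt (n₁ ⬝ᵥ n₁) * Real.sqrt (n₂ ⬝ᵥ n₂)))

/-- Open half spaces are measurable. [folklore] -/
theorem measurableSet_halfSpace (n : Fin 3 → ℝ) : MeasurableSet (halfSpace n) := by
  have hc : Continuous fun x : Fin 3 → ℝ => x ⬝ᵥ n := by unfold dotProduct; fun_prop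
  exact (isOpen_lt continuous_const hc).measurableSet

/-- Lunes are measurable. [folklore] -/
theorem measurableSet_lune (n₁ n₂ : Fin 3 → ℝ) : MeasurableSet (lune n₁ n₂) :=
  (measurableSet_halfSpace n₁).inter (measurableSet_halfSpace n₂)

/-- A half space only depends on the direction of its normal. [folklore] -/
theorem halfSpace_smul {c : ℝ} (hc : 0 < c) (n : Fin 3 → ℝ) : halfSpace (c • n) = halfSpace n := by
  ext x; simp only [halfSpace, mem_setOf_eq, dotProduct_smul, smul_eq_mul]
  exact mul_pos_iff_of_pos_left hc

/-- `v ⬝ᵥ v ≥ 0`. [folklore] -/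
theorem real_dot_self_nonneg (v : Fin 3 → ℝ) : 0 ≤ v ⬝ᵥ v := by
  rw [dotProduct_self_fin3]; positivity

/-- `v ⬝ᵥ v > 0` for `v ≠ 0`. [folklore] -/
theorem real_dot_self_pos {v : Fin 3 → ℝ} (hv : v ≠ 0) : 0 < v ⬝ᵥ v :=
  lt_of_le_of_ne (real_dot_self_nonneg v) (fun h => hv (dotProduct_self_eq_zero.1 h.symm))

/-- Lagrange's identity `|a × b|² = |a|²|b|² - (a·b)²`. [folklore] -/
theorem cross_dot_cross_self (a b : Fin 3 → ℝ) :
    (a ⨯₃ b) ⬝ᵥ (a ⨯₃ b) = (a ⬝ᵥ a) * (b ⬝ᵥ b) - (a ⬝ᵥ b) ^ 2 := by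
  rw [cross_dot_cross]; rw [dotProduct_comm b a]; ring

/-! ### An orthonormal change of coordinates moving a lune to the standard wedge -/

section Frame

variable {n₁ n₂ : Fin 3 → ℝ}

/-- For independent `n₁, n₂` the cosine `-(n₁·n₂)/(|n₁||n₂|)` lies strictly between `-1` and `1`,
so the opening angle lies in `(0, π)`. [folklore] -/
theorem luneAngle_mem_Ioo (hk : n₁ ⨯₃ n₂ ≠ 0) : luneAngle n₁ n₂ ∈ Ioo 0 π := by
  have h1 : n₁ ≠ 0 := by
    rintro rfl; apply hk; ext i; fin_cases i <;> simp
  have h2 : n₂ ≠ 0 := by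
    rintro rfl; apply hk; ext i; fin_cases i <;> simp
  have hp1 := real_dot_self_pos h1
  have hp2 := real_dot_self_pos h2
  have hK := real_dot_self_pos hk
  rw [cross_dot_cross_self] at hK
  set c := -(n₁ ⬝ᵥ n₂) / (Real.sqrt (n₁ ⬝ᵥ n₁) * Real.sqrt (n₂ ⬝ᵥ n₂)) with hc
  have hs : Real.sqrt (n₁ ⬝ᵥ n₁) * Real.sqrt (n₂ ⬝ᵥ n₂) = Real.sqrt ((n₁ ⬝ᵥ n₁) * (n₂ ⬝ᵥ n₂)) :=
    (Real.sqrt_mul hp1.le _).symm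
  have hspos : 0 < Real.sqrt ((n₁ ⬝ᵥ n₁) * (n₂ ⬝ᵥ n₂)) := Real.sqrt_pos.2 (mul_pos hp1 hp2)
  have hc2 : c ^ 2 < 1 := by
    rw [hc, hs, div_pow, neg_sq, Real.sq_sqrt (mul_pos hp1 hp2).le, div_lt_one (mul_pos hp1 hp2)]
    linarith
  have hlt : -1 < c ∧ c < 1 := by
    constructor <;> nlinarith [hc2]
  refine ⟨?_, ?_⟩
  · unfold luneAngle; rw [← hc]
    exact Real.arccos_pos.2 hlt.2
  · unfold luneAngle; rw [← hc]
    exact Real.arccos_lt_pi.2 hlt.1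

end Frame

section Frame

variable {n₁ n₂ : Fin 3 → ℝ}

/-- The unit vector of `n`. [folklore] -/
def unitVec (n : Fin 3 → ℝ) : Fin 3 → ℝ := (Real.sqrt (n ⬝ᵥ n))⁻¹ • n

/-- Dot product of unit vectors. [folklore] -/
theorem unitVec_dot_unitVec (n m : Fin 3 → ℝ) :
    unitVec n ⬝ᵥ unitVec m = (n ⬝ᵥ m) / (Real.sqrt (n ⬝ᵥ n) * Real.sqrt (m ⬝ᵥ m)) := by
  simp only [unitVec, smul_dotProduct, dotProduct_smul, smul_eq_mul]
  rw [div_eq_mul_inv, mul_inv]; ring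

/-- A unit vector has dot square one. [folklore] -/
theorem unitVec_dot_self {n : Fin 3 → ℝ} (hn : n ≠ 0) : unitVec n ⬝ᵥ unitVec n = 1 := by
  rw [unitVec_dot_unitVec, ← Real.sqrt_mul (real_dot_self_nonneg n), Real.sqrt_mul_self
    (real_dot_self_nonneg n)]
  exact div_self (real_dot_self_pos hn).ne'

/-- Normalising the normal does not change the half space. [folklore] -/
theorem halfSpace_unitVec {n : Fin 3 → ℝ} (hn : n ≠ 0) : halfSpace (unitVec n) = halfSpace n :=
  halfSpace_smul (inv_pos.2 (Real.sqrt_pos.2 (real_dot_self_pos hn))) n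

/-- First frame vector: the unit vector of the plane `span(n₁, n₂)` orthogonal to `n₁` on the side
of `n₂`, namely `(n̂₂ + cos α n̂₁) / sin α`. [folklore] -/
def frame₀ (n₁ n₂ : Fin 3 → ℝ) : Fin 3 → ℝ :=
  (Real.sin (luneAngle n₁ n₂))⁻¹ • (unitVec n₂ + Real.cos (luneAngle n₁ n₂) • unitVec n₁)

/-- The orthonormal frame matrix with rows `frame₀, n̂₁, frame₀ × n̂₁`. [folklore] -/
def frameMatrix (n₁ n₂ : Fin 3 → ℝ) : Matrix (Fin 3) (Fin 3) ℝ :=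
  ![frame₀ n₁ n₂, unitVec n₁, frame₀ n₁ n₂ ⨯₃ unitVec n₁]

/-- `cos α = -n̂₁·n̂₂` for the opening angle `α`. [folklore] -/
theorem cos_luneAngle (hk : n₁ ⨯₃ n₂ ≠ 0) :
    Real.cos (luneAngle n₁ n₂) = -(unitVec n₁ ⬝ᵥ unitVec n₂) := by
  have h := luneAngle_mem_Ioo hk
  unfold luneAngle
  rw [unitVec_dot_unitVec, Real.cos_arccos]
  · ring
  · -- from the strict bounds used in `luneAngle_mem_Ioo`
    by_contra hlt; rw [not_le] at hlt
    have : Real.arccos (-(n₁ ⬝ᵥ n₂) / (Real.sqrt (n₁ ⬝ᵥ n₁) * Real.sqrt (n₂ ⬝ᵥ n₂))) = π :=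
      Real.arccos_of_le_neg_one hlt.le
    exact absurd this (ne_of_lt h.2)
  · by_contra hlt; rw [not_le] at hlt
    have : Real.arccos (-(n₁ ⬝ᵥ n₂) / (Real.sqrt (n₁ ⬝ᵥ n₁) * Real.sqrt (n₂ ⬝ᵥ n₂))) = 0 :=
      Real.arccos_of_one_le hlt.le
    exact absurd this (ne_of_gt h.1)

/-- `sin α > 0` for the opening angle `α ∈ (0, π)`. [folklore] -/
theorem sin_luneAngle_pos (hk : n₁ ⨯₃ n₂ ≠ 0) : 0 < Real.sin (luneAngle n₁ n₂) :=
  Real.sin_pos_of_mem_Ioo (luneAngle_mem_Ioo hk)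

/-- `frame₀ ⊥ n̂₁`. [folklore] -/
theorem frame₀_dot_unitVec (hk : n₁ ⨯₃ n₂ ≠ 0) : frame₀ n₁ n₂ ⬝ᵥ unitVec n₁ = 0 := by
  have h1 : n₁ ≠ 0 := by
    rintro rfl; apply hk; ext i; fin_cases i <;> simp
  have hc := cos_luneAngle hk
  unfold frame₀
  rw [smul_dotProduct, add_dotProduct, smul_dotProduct, unitVec_dot_self h1, dotProduct_comm, smul_eq_mul,
    smul_eq_mul, mul_one, hc]
  ring

/-- `frame₀` is a unit vector. [folklore] -/
theorem frame₀_dot_self (hk : n₁ ⨯₃ n₂ ≠ 0) : frame₀ n₁ n₂ ⬝ᵥ frame₀ n₁ n₂ = 1 := by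
  have h1 : n₁ ≠ 0 := by
    rintro rfl; apply hk; ext i; fin_cases i <;> simp
  have h2 : n₂ ≠ 0 := by
    rintro rfl; apply hk; ext i; fin_cases i <;> simp
  have hc := cos_luneAngle hk
  have hs := sin_luneAngle_pos hk
  have hcs := Real.sin_sq_add_cos_sq (luneAngle n₁ n₂)
  unfold frame₀
  simp only [smul_dotProduct, dotProduct_smul, add_dotProduct, dotProduct_add, smul_eq_mul,
    unitVec_dot_self h1, unitVec_dot_self h2]
  rw [dotProduct_comm (unitVec n₂) (unitVec n₁)]
  set c := Real.cos (luneAngle n₁ n₂) with hcdef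
  set si := Real.sin (luneAngle n₁ n₂) with hsdef
  have hd : unitVec n₁ ⬝ᵥ unitVec n₂ = -c := by rw [hc]; ring
  rw [hd]
  field_simp
  nlinarith [hcs]

end Frame

section Transfer

variable {n₁ n₂ : Fin 3 → ℝ}

/-- The frame matrix computes the coordinates in the frame. [folklore] -/
theorem frameMatrix_mulVec_apply (n₁ n₂ x : Fin 3 → ℝ) :
    frameMatrix n₁ n₂ *ᵥ x = ![frame₀ n₁ n₂ ⬝ᵥ x, unitVec n₁ ⬝ᵥ x, (frame₀ n₁ n₂ ⨯₃ unitVec n₁) ⬝ᵥ x] := by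
  ext i; fin_cases i <;> rfl

/-- The frame matrix has determinant one. [folklore] -/
theorem det_frameMatrix (hk : n₁ ⨯₃ n₂ ≠ 0) : (frameMatrix n₁ n₂).det = 1 := by
  have h1 : n₁ ≠ 0 := by
    rintro rfl; apply hk; ext i; fin_cases i <;> simp
  unfold frameMatrix
  rw [← triple_product_eq_det, cross_cross_eq_smul_sub_smul', dotProduct_sub, dotProduct_smul,
    dotProduct_smul, unitVec_dot_self h1, frame₀_dot_self hk, smul_eq_mul, smul_eq_mul,
    frame₀_dot_unitVec hk]
  ring

/-- The frame matrix is orthogonal: it preserves the dot square (Parseval). [folklore] -/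
theorem frameMatrix_mulVec_dot_self (hk : n₁ ⨯₃ n₂ ≠ 0) (x : Fin 3 → ℝ) :
    (frameMatrix n₁ n₂ *ᵥ x) ⬝ᵥ (frameMatrix n₁ n₂ *ᵥ x) = x ⬝ᵥ x := by
  have h1 : n₁ ≠ 0 := by
    rintro rfl; apply hk; ext i; fin_cases i <;> simp
  set g₀ := frame₀ n₁ n₂ with hg₀
  set g₁ := unitVec n₁ with hg₁
  have h00 : g₀ ⬝ᵥ g₀ = 1 := frame₀_dot_self hk
  have h11 : g₁ ⬝ᵥ g₁ = 1 := unitVec_dot_self h1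
  have h01 : g₀ ⬝ᵥ g₁ = 0 := frame₀_dot_unitVec hk
  have h10 : g₁ ⬝ᵥ g₀ = 0 := by rw [dotProduct_comm]; exact h01
  have hL := cross_dot_cross_self x (g₀ ⨯₃ g₁)
  have hL2 := cross_dot_cross_self g₀ g₁
  rw [h00, h11, h01] at hL2
  have hx : x ⨯₃ (g₀ ⨯₃ g₁) = (x ⬝ᵥ g₁) • g₀ - (g₀ ⬝ᵥ x) • g₁ := cross_cross_eq_smul_sub_smul' x g₀ g₁
  rw [hx] at hL
  simp only [sub_dotProduct, dotProduct_sub, smul_dotProduct, dotProduct_smul, smul_eq_mul, h00, h11,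
    h01, h10, hL2] at hL
  rw [frameMatrix_mulVec_apply]
  simp only [dotProduct, Fin.sum_univ_three, Matrix.cons_val_zero, Matrix.cons_val_one,
    Matrix.cons_val_two, Matrix.head_cons, Matrix.tail_cons] at hL ⊢
  have e1 : (g₀ ⨯₃ g₁) 0 * x 0 + (g₀ ⨯₃ g₁) 1 * x 1 + (g₀ ⨯₃ g₁) 2 * x 2
      = x 0 * (g₀ ⨯₃ g₁) 0 + x 1 * (g₀ ⨯₃ g₁) 1 + x 2 * (g₀ ⨯₃ g₁) 2 := by ring
  have e2 : g₀ 0 * x 0 + g₀ 1 * x 1 + g₀ 2 * x 2 = x 0 * g₀ 0 + x 1 * g₀ 1 + x 2 * g₀ 2 := by ring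
  have e3 : g₁ 0 * x 0 + g₁ 1 * x 1 + g₁ 2 * x 2 = x 0 * g₁ 0 + x 1 * g₁ 1 + x 2 * g₁ 2 := by ring
  rw [e1]
  nlinarith [hL, e2, e3]

/-- `toLin'` of the frame matrix preserves Lebesgue measure. [folklore] -/
theorem measurePreserving_frameMatrix (hk : n₁ ⨯₃ n₂ ≠ 0) :
    MeasurePreserving (Matrix.toLin' (frameMatrix n₁ n₂)) volume volume := by
  refine ⟨(LinearMap.continuous_on_pi _).measurable, ?_⟩
  have hdet : (frameMatrix n₁ n₂).det ≠ 0 := by rw [det_frameMatrix hk]; norm_num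
  rw [Real.map_matrix_volume_pi_eq_smul_volume_pi hdet, det_frameMatrix hk]
  simp

/-- `sin α · frame₀ - cos α · n̂₁ = n̂₂`. [folklore] -/
theorem sin_smul_frame₀_sub (hk : n₁ ⨯₃ n₂ ≠ 0) :
    Real.sin (luneAngle n₁ n₂) • frame₀ n₁ n₂ - Real.cos (luneAngle n₁ n₂) • unitVec n₁ = unitVec n₂ := by
  unfold frame₀
  rw [smul_smul, mul_inv_cancel₀ (sin_luneAngle_pos hk).ne', one_smul]
  abel

/-- The frame matrix moves the lune onto the standard wedge and fixes the round ball. [folklore] -/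
theorem preimage_stdWedge_inter_ball₃ (hk : n₁ ⨯₃ n₂ ≠ 0) (R : ℝ) :
    (Matrix.toLin' (frameMatrix n₁ n₂)) ⁻¹' (stdWedge (luneAngle n₁ n₂) ∩ ball₃ R)
      = lune n₁ n₂ ∩ ball₃ R := by
  have h1 : n₁ ≠ 0 := by
    rintro rfl; apply hk; ext i; fin_cases i <;> simp
  have h2 : n₂ ≠ 0 := by
    rintro rfl; apply hk; ext i; fin_cases i <;> simp
  ext x
  simp only [mem_preimage, Matrix.toLin'_apply, mem_inter_iff, stdWedge, ball₃, mem_setOf_eq,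
    frameMatrix_mulVec_dot_self hk]
  rw [frameMatrix_mulVec_apply]
  simp only [Matrix.cons_val_zero, Matrix.cons_val_one]
  have hrot : frame₀ n₁ n₂ ⬝ᵥ x * Real.sin (luneAngle n₁ n₂) - unitVec n₁ ⬝ᵥ x * Real.cos (luneAngle n₁ n₂)
      = unitVec n₂ ⬝ᵥ x := by
    rw [← sin_smul_frame₀_sub hk, sub_dotProduct, smul_dotProduct, smul_dotProduct, smul_eq_mul,
      smul_eq_mul]; ring
  rw [hrot]
  have hl : lune n₁ n₂ = halfSpace (unitVec n₁) ∩ halfSpace (unitVec n₂) := by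
    rw [halfSpace_unitVec h1, halfSpace_unitVec h2]; rfl
  rw [hl]
  simp only [halfSpace, mem_inter_iff, mem_setOf_eq, dotProduct_comm x]

/-- **A lune of opening angle `α` occupies the fraction `α/(2π)` of the round ball.** [folklore] -/
theorem volume_lune_inter_ball₃ (hk : n₁ ⨯₃ n₂ ≠ 0) (R : ℝ) :
    volume (lune n₁ n₂ ∩ ball₃ R) = ENNReal.ofReal (luneAngle n₁ n₂ / (2 * π)) * volume (ball₃ R) := by
  have h := luneAngle_mem_Ioo hk
  rw [← preimage_stdWedge_inter_ball₃ hk R, (measurePreserving_frameMatrix hk).measure_preimage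
    ((measurableSet_stdWedge _).inter (measurableSet_ball₃ R)).nullMeasurableSet]
  exact volume_stdWedge_inter_ball₃ h.1 h.2.le R

end Transfer

end KY

end Literature.Analysis.FluidPDE
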